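/-
Copyright (c) 2026. Released under Apache 2.0 license.
Literature formalization: Chen–Voutier, §3.1 (the approximating sequences for the simplest quartic
Thue equation), analytic part: the bounds (3.12)–(3.13).
-/
import Mathlib
import Literature.NumberTheory.DiophantineGeometry.SimplestQuarticThueApproximants
import Literature.NumberTheory.DiophantineGeometry.SimplestQuarticThueApproximationConstants
import Literature.NumberTheory.DiophantineApproximation.BinomialPadeRemainder

/-!
# The hypergeometric approximants for the roots of `X⁴ - tX³ - 6X² + tX + 1` — bounds

[cite: ChenVoutier1997, §3.1 (arXiv:1401.5450): `w = e^{iφ}`, `√w = ε/ρ + i/ρ` (i.e. `w^{1/4}`),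
`|u'(1+√w)²| = 8ε`, `|u'(1-√w)²| = 8/ε`, and the estimates (3.12), (3.13)]

J. H. Chen and P. M. Voutier, *Complete solution of the Diophantine equation `X² + 1 = dY⁴` and a
related family of quartic Thue equations*, J. Number Theory **62** (1997), 71–99.

With `ε - 1/ε = t/2`, `ρ² = 1 + ε²`, `z' = 4 - ti`, `u' = -4 - ti`, `w = z'/u'` we show
`w = e^{iφ}` for `φ = 4 arctan(1/ε)` with `w^{1/4} = e^{iφ/4} = (ε + i)/ρ` (`cexp_four_arctan_inv`,
`cexp_arctan_inv`), `|u'| · |1 - √w|² = 8/ε` (`norm_u'_mul_norm_one_sub_sqrtw_sq`), and derive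
from the Padé remainder bound along the arc (`BinomialPadeRemainder`, Lemmas 2, 3, 5) the estimate
`‖w^{1/4} Q_r - P_r‖ ≤ (1/ε) (8/ε)^r` for `P_r = u'^r p_r(w)`, `Q_r = u'^r q_r(w)`
(`norm_omega_mul_Q_sub_P_le`; this is `|u(0)^r R_r(w)| · C(r-1/4,r) · 8^r` in the notation of
(3.13), with the constant `Γ(r+3/4)Γ(r+5/4)/(Γ(3/4)Γ(1/4) r!²) = (1/4) C(r-1/4,r) C(r+1/4,r) ≤ 1/4`
and `φ ≤ 4/ε`), together with the trivial growth estimate `‖P_r‖ ≤ C(2r,r) |u'|^r ≤ (4|u'|)^r`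
(`norm_P_le`, replacing Lemma 6: the rate `4|u'| = 4√(t²+16)` replaces `8ε` in (3.12)).
-/

open Finset Complex
open scoped ComplexConjugate

namespace Literature.NumberTheory.DiophantineGeometry.SimplestQuarticThue

open Literature.NumberTheory.DiophantineApproximation

variable {t ε ρ : ℝ}

/-! ### `w = e^{iφ}` and `w^{1/4} = (ε + i)/ρ` -/

/-- `tε = 2ε² - 2` [cite: ChenVoutier1997, §3, definition of `ε`]. -/
theorem t_mul_eps (hε : 0 < ε) (h : ε - ε⁻¹ = t / 2) : t * ε = 2 * ε ^ 2 - 2 := by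
  have hne : ε ≠ 0 := hε.ne'
  field_simp at h
  linarith

/-- `e^{i arctan(1/ε)} = (ε + i)/ρ`: the fourth root `w^{1/4}` of §3.1 (printed as
"`√w = ε/ρ + i/ρ`") [cite: ChenVoutier1997, §3.1]. -/
theorem cexp_arctan_inv (hε : 0 < ε) (hρ : 0 < ρ) (hρ2 : ρ ^ 2 = 1 + ε ^ 2) :
    cexp (↑(Real.arctan (1 / ε)) * I) = ((ε : ℂ) + I) / ρ := by
  have hsq : Real.sqrt (1 + (1 / ε) ^ 2) = ρ / ε := by
    rw [show 1 + (1 / ε) ^ 2 = (ρ / ε) ^ 2 by field_simp; nlinarith [hρ2],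
      Real.sqrt_sq (by positivity)]
  apply Complex.ext
  · rw [exp_ofReal_mul_I_re, Real.cos_arctan, hsq, div_ofReal_re]
    simp only [add_re, ofReal_re, I_re, add_zero]
    field_simp
  · rw [exp_ofReal_mul_I_im, Real.sin_arctan, hsq, div_ofReal_im]
    simp only [add_im, ofReal_im, I_im, zero_add]
    field_simp

/-- `((ε + i)/ρ)⁴ = w = z'/u'` [cite: ChenVoutier1997, §3.1, `w = (t²-16)/(t²+16) + i 8t/(t²+16)`]. -/
theorem omega_pow_four (hε : 0 < ε) (h : ε - ε⁻¹ = t / 2) (hρ : 0 < ρ)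
    (hρ2 : ρ ^ 2 = 1 + ε ^ 2) :
    (((ε : ℂ) + I) / ρ) ^ 4 = (4 - (t : ℂ) * I) / (-4 - (t : ℂ) * I) := by
  have hεt := t_mul_eps hε h
  have hεt' : (t : ℂ) * ε = 2 * (ε : ℂ) ^ 2 - 2 := by exact_mod_cast hεt
  have hρ' : (ρ : ℂ) ^ 2 = 1 + (ε : ℂ) ^ 2 := by exact_mod_cast hρ2
  have hII : I * I = -1 := I_mul_I
  have hu : (-4 - (t : ℂ) * I) ≠ 0 := by
    intro h0
    have := congrArg Complex.re h0
    simp at this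
  have hρ0 : (ρ : ℂ) ≠ 0 := by exact_mod_cast hρ.ne'
  rw [div_pow, div_eq_div_iff (pow_ne_zero 4 hρ0) hu]
  linear_combination (4 * ((ε : ℂ) ^ 2 - 1) + 8 * ε * I) * hεt' +
    ((6 * (ε : ℂ) ^ 2 + 4 * ε * I + I * I - 1) * (-4 - (t : ℂ) * I) -
      (t : ℂ) * (4 * (ε : ℂ) ^ 3 - 4 * ε)) * hII -
    (4 - (t : ℂ) * I) * ((ρ : ℂ) ^ 2 + 1 + (ε : ℂ) ^ 2) * hρ'

/-- `w = e^{iφ}` with `φ = 4 arctan(1/ε)` [cite: ChenVoutier1997, §3.1, "we can write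
`w = e^{iφ}`, where `0 < φ < π/2`"]. -/
theorem cexp_four_arctan_inv (hε : 0 < ε) (h : ε - ε⁻¹ = t / 2) (hρ : 0 < ρ)
    (hρ2 : ρ ^ 2 = 1 + ε ^ 2) :
    cexp (↑(4 * Real.arctan (1 / ε)) * I) = (4 - (t : ℂ) * I) / (-4 - (t : ℂ) * I) := by
  rw [show (4 : ℝ) * Real.arctan (1 / ε) = ((4 : ℕ) : ℝ) * Real.arctan (1 / ε) by norm_num,
    cexp_natCast_mul_I, cexp_arctan_inv hε hρ hρ2, omega_pow_four hε h hρ hρ2]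

/-- `√w = e^{iφ/2} = ((ε+i)/ρ)²` [cite: ChenVoutier1997, §3.1, `√w = e^{iφ/2}`]. -/
theorem cexp_two_arctan_inv (hε : 0 < ε) (hρ : 0 < ρ) (hρ2 : ρ ^ 2 = 1 + ε ^ 2) :
    cexp (↑(4 * Real.arctan (1 / ε) / 2) * I) = (((ε : ℂ) + I) / ρ) ^ 2 := by
  rw [show (4 : ℝ) * Real.arctan (1 / ε) / 2 = ((2 : ℕ) : ℝ) * Real.arctan (1 / ε) by ring,
    cexp_natCast_mul_I, cexp_arctan_inv hε hρ hρ2]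

/-- `0 < φ = 4 arctan(1/ε) ≤ 4/ε` and `φ ≤ 2π` [cite: ChenVoutier1997, §3.1 and the estimate
`2φ/π ≤ sin φ` before (3.13); here the sharper `arctan x ≤ x`]. -/
theorem four_arctan_inv_bounds (hε : 0 < ε) :
    0 ≤ 4 * Real.arctan (1 / ε) ∧ 4 * Real.arctan (1 / ε) ≤ 4 / ε ∧
      4 * Real.arctan (1 / ε) ≤ 2 * Real.pi := by
  have h1 : 0 < Real.arctan (1 / ε) := by
    rw [← Real.arctan_zero]
    exact Real.arctan_strictMono (by positivity)
  have h2 : Real.arctan (1 / ε) < Real.pi / 2 := Real.arctan_lt_pi_div_two _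
  have h3 : Real.arctan (1 / ε) ≤ 1 / ε := by
    have := Real.lt_tan h1 h2
    rw [Real.tan_arctan] at this
    exact this.le
  refine ⟨by linarith, ?_, by linarith [Real.pi_pos]⟩
  calc 4 * Real.arctan (1 / ε) ≤ 4 * (1 / ε) := by linarith
    _ = 4 / ε := by ring

/-! ### Moduli: `|u'| = 4ε - t` and `|u'| · |1 - √w|² = 8/ε` -/

/-- `‖u'‖ = ‖-4 - ti‖ = √(t² + 16) = 4ε - t` [cite: ChenVoutier1997, §3.1]. -/
theorem norm_u' (hε : 0 < ε) (h : ε - ε⁻¹ = t / 2) : ‖(-4 - (t : ℂ) * I)‖ = 4 * ε - t := by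
  rw [← sqrt_sq_add_sixteen hε h, Complex.norm_def, normSq_apply]
  congr 1
  simp [sq]
  ring

/-- `‖z'‖ = ‖u'‖` [cite: ChenVoutier1997, §3.1, "`|u'| = |z'|`"]. -/
theorem norm_z'_eq_norm_u' (t : ℝ) : ‖(4 - (t : ℂ) * I)‖ = ‖(-4 - (t : ℂ) * I)‖ := by
  rw [Complex.norm_def, Complex.norm_def, normSq_apply, normSq_apply]
  congr 1
  simp

/-- `ρ² (1 - ((ε+i)/ρ)²) = 2 - 2εi` [cite: ChenVoutier1997, §3.1, computation of `|1 - √w|`]. -/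
theorem rho_sq_mul_one_sub_omega_sq (hρ : 0 < ρ) (hρ2 : ρ ^ 2 = 1 + ε ^ 2) :
    (ρ : ℂ) ^ 2 * (1 - (((ε : ℂ) + I) / ρ) ^ 2) = 2 - 2 * (ε : ℂ) * I := by
  have hρ' : (ρ : ℂ) ^ 2 = 1 + (ε : ℂ) ^ 2 := by exact_mod_cast hρ2
  have hρ0 : (ρ : ℂ) ≠ 0 := by exact_mod_cast hρ.ne'
  have hII : I * I = -1 := I_mul_I
  field_simp
  linear_combination hρ' - hII

/-- `‖1 - √w‖² = 4/ρ²` [cite: ChenVoutier1997, §3.1]. -/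
theorem norm_one_sub_omega_sq_sq (hρ : 0 < ρ) (hρ2 : ρ ^ 2 = 1 + ε ^ 2) :
    ‖1 - (((ε : ℂ) + I) / ρ) ^ 2‖ ^ 2 = 4 / ρ ^ 2 := by
  have key := rho_sq_mul_one_sub_omega_sq hρ hρ2 (ε := ε)
  have hn : ‖(ρ : ℂ) ^ 2 * (1 - (((ε : ℂ) + I) / ρ) ^ 2)‖ ^ 2 = ‖(2 : ℂ) - 2 * (ε : ℂ) * I‖ ^ 2 := by
    rw [key]
  rw [norm_mul, mul_pow, norm_pow, Complex.norm_real, Real.norm_eq_abs, abs_of_pos hρ,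
    Complex.sq_norm (2 - 2 * (ε : ℂ) * I), normSq_apply] at hn
  simp only [sub_re, sub_im, mul_re, mul_im, re_ofNat, im_ofNat, ofReal_re, ofReal_im, I_re,
    I_im, mul_zero, mul_one, zero_mul, sub_zero, zero_sub, add_zero] at hn
  have hρ4 : 0 < ρ ^ 2 := by positivity
  rw [eq_div_iff hρ4.ne']
  nlinarith [hn, hρ2]

/-- **`|u'| · |1 - √w|² = 8/ε`** [cite: ChenVoutier1997, §3.1, display before (3.13):
"`|u'(1-√w)²| = 8/ε`"]. -/
theorem norm_u'_mul_norm_one_sub_sqrtw_sq (hε : 0 < ε) (h : ε - ε⁻¹ = t / 2) (hρ : 0 < ρ)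
    (hρ2 : ρ ^ 2 = 1 + ε ^ 2) :
    ‖(-4 - (t : ℂ) * I)‖ * ‖1 - (((ε : ℂ) + I) / ρ) ^ 2‖ ^ 2 = 8 / ε := by
  rw [norm_u' hε h, norm_one_sub_omega_sq_sq hρ hρ2, hρ2]
  have hεt := t_mul_eps hε h
  have hε0 : ε ≠ 0 := hε.ne'
  field_simp
  nlinarith [hεt]

/-! ### The size of the coefficients -/

/-- `C(r-1/4, r-ν) C(r+1/4, ν) ≥ 0` for `ν ≤ r` [folklore]. -/
theorem pcoeff_quarter_nonneg {r ν : ℕ} (hν : ν ≤ r) :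
    0 ≤ Ring.choose ((r : ℝ) - 1 / 4) (r - ν) * Ring.choose ((r : ℝ) + 1 / 4) ν := by
  rw [ring_choose_eq_prod_div, ring_choose_eq_prod_div]
  refine mul_nonneg (div_nonneg (prod_nonneg fun l hl => ?_) (by positivity))
    (div_nonneg (prod_nonneg fun l hl => ?_) (by positivity))
  · have : (l : ℝ) + 1 ≤ ((r - ν : ℕ) : ℝ) := by exact_mod_cast mem_range.mp hl
    rw [Nat.cast_sub hν] at this
    have hν0 : (0 : ℝ) ≤ ν := by positivity
    linarith
  · have : (l : ℝ) + 1 ≤ ν := by exact_mod_cast mem_range.mp hl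
    have : (ν : ℝ) ≤ r := by exact_mod_cast hν
    linarith

/-- `∑_ν C(r-1/4, r-ν) C(r+1/4, ν) = p_r(1) = C(2r, r)` [cite: ChenVoutier1997, proof of Lemma 6,
the value `₂F₁(-r,-r-1/n;1-1/n;1)` by Vandermonde]. -/
theorem sum_pcoeff_quarter (r : ℕ) :
    ∑ ν ∈ range (r + 1), Ring.choose ((r : ℝ) - 1 / 4) (r - ν) * Ring.choose ((r : ℝ) + 1 / 4) ν =
      ((2 * r).choose r : ℝ) := by
  have h := binomialPadeP_eq_sum_pow_sub_one (1 / 4) r r 1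
  simp only [one_pow, mul_one, sub_self] at h
  have e : Ring.choose ((r : ℝ) + r) r = ((2 * r).choose r : ℝ) := by
    have := ring_choose_two_mul_sub r 0 (Nat.zero_le _)
    simpa using this
  have hR : ∑ x ∈ range (r + 1), ((Ring.choose ((r : ℝ) + 1 / 4) x *
      Ring.choose ((r : ℝ) + r - x) r : ℝ) : ℂ) * (0 : ℂ) ^ x = (((2 * r).choose r : ℝ) : ℂ) := by
    rw [sum_range_succ']
    simp [e]
  rw [hR, ← ofReal_sum] at h
  exact_mod_cast h

/-- **`‖P_r‖ ≤ C(2r,r) |u'|^r`** (the trivial estimate replacing [cite: ChenVoutier1997, Lemma 6]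
in (3.12)). -/
theorem norm_P_le (t : ℝ) (r : ℕ) :
    ‖∑ ν ∈ range (r + 1), ((Ring.choose ((r : ℝ) - 1 / 4) (r - ν) *
        Ring.choose ((r : ℝ) + 1 / 4) ν : ℝ) : ℂ) * (4 - (t : ℂ) * I) ^ ν *
          (-4 - (t : ℂ) * I) ^ (r - ν)‖ ≤ ((2 * r).choose r : ℝ) * ‖(-4 - (t : ℂ) * I)‖ ^ r := by
  refine (norm_sum_le _ _).trans (le_of_eq ?_)
  rw [← sum_pcoeff_quarter, sum_mul]
  refine sum_congr rfl fun ν hν => ?_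
  have hνr : ν ≤ r := Nat.lt_succ_iff.mp (mem_range.mp hν)
  rw [norm_mul, norm_mul, norm_pow, norm_pow, norm_z'_eq_norm_u', Complex.norm_real,
    Real.norm_eq_abs, abs_of_nonneg (pcoeff_quarter_nonneg hνr), mul_assoc, ← pow_add,
    Nat.add_sub_cancel' hνr]

/-- `C(2r, r) ≤ 4^r` [folklore]. -/
theorem centralBinom_le_four_pow_real (r : ℕ) : ((2 * r).choose r : ℝ) ≤ 4 ^ r := by
  have h : (2 * r).choose r ≤ 4 ^ r := by
    rw [← Nat.centralBinom_eq_two_mul_choose]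
    exact Nat.centralBinom_le_four_pow r
  exact_mod_cast h

/-- `C(r-1/4,r) C(r+1/4,r) ≤ 1`, i.e. `Γ(r+3/4)Γ(r+5/4)/(Γ(3/4)Γ(1/4)(r!)²) ≤ 1/4`
[cite: ChenVoutier1997, proof of Theorem 5, "`Γ(r+3/4)Γ(r+5/4)/(2Γ(3/4)r! Γ(1/4)r!) ≤ 1/8`"]. -/
theorem choose_quarter_mul_choose_quarter_le_one (r : ℕ) :
    Ring.choose ((r : ℝ) - 1 / 4) r * Ring.choose ((r : ℝ) + 1 / 4) r ≤ 1 := by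
  rw [ring_choose_eq_prod_div, ring_choose_eq_prod_div, div_mul_div_comm, ← prod_mul_distrib]
  have hfac : ((r.factorial : ℕ) : ℝ) = ∏ l ∈ range r, ((r : ℝ) - l) := by
    rw [← prod_range_reflect, ← Finset.prod_range_add_one_eq_factorial, Nat.cast_prod]
    refine prod_congr rfl fun l hl => ?_
    have hl' := mem_range.mp hl
    rw [Nat.cast_sub (by omega : l ≤ r - 1), Nat.cast_sub (by omega : 1 ≤ r)]
    push_cast
    ring
  have hpos : (0 : ℝ) < (r.factorial : ℕ) * (r.factorial : ℕ) := by positivity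
  rw [div_le_one hpos, hfac, ← prod_mul_distrib]
  refine prod_le_prod (fun l hl => ?_) (fun l hl => ?_)
  · have : (l : ℝ) + 1 ≤ r := by exact_mod_cast mem_range.mp hl
    nlinarith
  · nlinarith

/-! ### The remainder at `w` -/

/-- **`‖w^{1/4} Q_r - P_r‖ ≤ (1/ε)(8/ε)^r`** for `P_r = u'^r p_r(w)`, `Q_r = u'^r q_r(w)`,
`w^{1/4} = (ε+i)/ρ` [cite: ChenVoutier1997, §3.1, (3.4) and (3.13): `Q_r^{(j)} β^{(j)} - P_r^{(j)}
= S_r^{(j)}`, `|S_r^{(j)}| ≤ (πt/(16+t²)) (8/ε)^r`; here from Lemmas 2, 3, 5 along the arc with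
`φ ≤ 4/ε` and `(1/4) C(r-1/4,r) C(r+1/4,r) ≤ 1/4`]. -/
theorem norm_omega_mul_Q_sub_P_le {t : ℤ} (hε : 0 < ε) (h : ε - ε⁻¹ = (t : ℝ) / 2) (hρ : 0 < ρ)
    (hρ2 : ρ ^ 2 = 1 + ε ^ 2) (r : ℕ) :
    ‖((ε : ℂ) + I) / ρ * ∑ ν ∈ range (r + 1), ((Ring.choose ((r : ℝ) - 1 / 4) ν *
        Ring.choose ((r : ℝ) + 1 / 4) (r - ν) : ℝ) : ℂ) * (4 - ((t : ℝ) : ℂ) * I) ^ ν *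
          (-4 - ((t : ℝ) : ℂ) * I) ^ (r - ν) -
      ∑ ν ∈ range (r + 1), ((Ring.choose ((r : ℝ) - 1 / 4) (r - ν) *
        Ring.choose ((r : ℝ) + 1 / 4) ν : ℝ) : ℂ) * (4 - ((t : ℝ) : ℂ) * I) ^ ν *
          (-4 - ((t : ℝ) : ℂ) * I) ^ (r - ν)‖ ≤ 1 / ε * (8 / ε) ^ r := by
  set u : ℂ := -4 - ((t : ℝ) : ℂ) * I with hu_def
  set z : ℂ := 4 - ((t : ℝ) : ℂ) * I with hz_def
  set ω : ℂ := ((ε : ℂ) + I) / ρ with hω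
  have hu : u ≠ 0 := by
    intro h0
    have := congrArg Complex.re h0
    simp [hu_def] at this
  obtain ⟨hφ0, hφε, hφπ⟩ := four_arctan_inv_bounds hε
  set φ : ℝ := 4 * Real.arctan (1 / ε) with hφ
  have hw : cexp (↑φ * I) = z / u := cexp_four_arctan_inv hε h hρ hρ2
  have hωe : cexp (↑((1 / 4 : ℝ) * φ) * I) = ω := by
    rw [hφ, show (1 / 4 : ℝ) * (4 * Real.arctan (1 / ε)) = Real.arctan (1 / ε) by ring]
    exact cexp_arctan_inv hε hρ hρ2
  have hsq : cexp (↑(φ / 2) * I) = ω ^ 2 := cexp_two_arctan_inv hε hρ hρ2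
  -- the Padé remainder bound along the arc, at `w`
  have hR := binomialPade_remainder_arc_norm_le (1 / 4) r hφ0 hφπ
  rw [hw, hωe, hsq] at hR
  -- homogenise
  rw [homog_eq_pow_mul_sum _ z u hu, homog_eq_pow_mul_sum _ z u hu,
    show ω * (u ^ r * ∑ ν ∈ range (r + 1), ((Ring.choose ((r : ℝ) - 1 / 4) ν *
        Ring.choose ((r : ℝ) + 1 / 4) (r - ν) : ℝ) : ℂ) * (z / u) ^ ν) -
      u ^ r * ∑ ν ∈ range (r + 1), ((Ring.choose ((r : ℝ) - 1 / 4) (r - ν) *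
        Ring.choose ((r : ℝ) + 1 / 4) ν : ℝ) : ℂ) * (z / u) ^ ν =
      u ^ r * (ω * ∑ ν ∈ range (r + 1), ((Ring.choose ((r : ℝ) - 1 / 4) ν *
        Ring.choose ((r : ℝ) + 1 / 4) (r - ν) : ℝ) : ℂ) * (z / u) ^ ν -
      ∑ ν ∈ range (r + 1), ((Ring.choose ((r : ℝ) - 1 / 4) (r - ν) *
        Ring.choose ((r : ℝ) + 1 / 4) ν : ℝ) : ℂ) * (z / u) ^ ν) by ring, norm_mul, norm_pow]
  have hCC : |1 / 4 * (Ring.choose ((r : ℝ) - 1 / 4) r * Ring.choose ((r : ℝ) + 1 / 4) r)| ≤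
      1 / 4 := by
    rw [abs_of_nonneg (by
      have h1 := ring_choose_sub_self_pos (by norm_num : (1 / 4 : ℝ) < 1) r
      have h2 := ring_choose_add_self_pos (by norm_num : (-1 : ℝ) < 1 / 4) r
      positivity)]
    linarith [choose_quarter_mul_choose_quarter_le_one r]
  have h8 : ‖u‖ * ‖1 - ω ^ 2‖ ^ 2 = 8 / ε := norm_u'_mul_norm_one_sub_sqrtw_sq hε h hρ hρ2
  have hnn : 0 ≤ ‖1 - ω ^ 2‖ ^ (2 * r) := by positivity
  calc ‖u‖ ^ r * _ ≤ ‖u‖ ^ r * (|1 / 4 * (Ring.choose ((r : ℝ) - 1 / 4) r *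
        Ring.choose ((r : ℝ) + 1 / 4) r)| * φ * ‖1 - ω ^ 2‖ ^ (2 * r)) :=
        mul_le_mul_of_nonneg_left hR (by positivity)
    _ ≤ ‖u‖ ^ r * (1 / 4 * (4 / ε) * ‖1 - ω ^ 2‖ ^ (2 * r)) := by
        refine mul_le_mul_of_nonneg_left ?_ (by positivity)
        refine mul_le_mul ?_ le_rfl hnn (by positivity)
        exact mul_le_mul hCC hφε hφ0 (by norm_num)
    _ = 1 / ε * (‖u‖ * ‖1 - ω ^ 2‖ ^ 2) ^ r := by rw [mul_pow, ← pow_mul]; ring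
    _ = 1 / ε * (8 / ε) ^ r := by rw [h8]

end Literature.NumberTheory.DiophantineGeometry.SimplestQuarticThue
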